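import Summits.Ventures.PercRepro0.Continuity

/-!
# Block L glue, kernel-checked: the uniform coupling (L1) and right-continuity of `θ` (L2/G4)

Cell pub-perc-repro0, seat p2.

* `map_threshold`    : thresholding i.i.d. uniforms at level `p` has law `P_p` (the standard coupling);
* `percMeasure_mono_of_increasing`, `θ_mono` : L1, `P_p(A) ≤ P_q(A)` for increasing `A`, `θ_d` nondecreasing;
* `θ_rightContinuous` : G4, `θ_d(q) → θ_d(p)` as `q ↓ p`.
-/

open MeasureTheory ProbabilityTheory

namespace Summit.Ventures.PercRepro0

variable {d : ℕ}

-- BEGIN BODY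

/-! ### The uniform coupling -/

/-- The product of uniform laws on `[0,1]`, one per bond. -/
noncomputable def uniformProd (d : ℕ) : Measure (Bond d → unitInterval) :=
  Measure.infinitePi fun _ : Bond d => (volume : Measure unitInterval)

/-- `uniformProd d` is a probability measure. -/
instance : IsProbabilityMeasure (uniformProd d) := by
  unfold uniformProd; infer_instance

/-- Thresholding one uniform variable at level `p`. -/
noncomputable def thresholdCoord (p : unitInterval) (u : unitInterval) : Bool := decide (u ≤ p)

/-- Thresholding all the uniforms at level `p`: the bond `b` is open iff `u b ≤ p`. -/
noncomputable def threshold (p : unitInterval) (u : Bond d → unitInterval) : Config d :=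
  fun b => thresholdCoord p (u b)

/-- The preimage of `{true}` under thresholding is `[0,p]`. -/
lemma thresholdCoord_preimage_true (p : unitInterval) :
    thresholdCoord p ⁻¹' {true} = Set.Iic p := by
  ext u; simp [thresholdCoord]

/-- The preimage of `{false}` under thresholding is `(p,1]`. -/
lemma thresholdCoord_preimage_false (p : unitInterval) :
    thresholdCoord p ⁻¹' {false} = Set.Ioi p := by
  ext u; simp [thresholdCoord]

/-- Thresholding one coordinate is measurable. -/
lemma measurable_thresholdCoord (p : unitInterval) : Measurable (thresholdCoord p) := by
  refine measurable_to_countable' fun c => ?_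
  cases c
  · rw [thresholdCoord_preimage_false]; exact measurableSet_Ioi
  · rw [thresholdCoord_preimage_true]; exact measurableSet_Iic

/-- The coupling map is measurable. -/
lemma measurable_threshold (p : unitInterval) : Measurable (threshold (d := d) p) :=
  measurable_pi_iff.2 fun b => (measurable_thresholdCoord p).comp (measurable_pi_apply b)

/-- `ENNReal.ofReal p = ↑(toNNReal p)` for `p ∈ [0,1]`. -/
lemma ofReal_eq_toNNReal (p : unitInterval) :
    ENNReal.ofReal (p : ℝ) = ((unitInterval.toNNReal p : NNReal) : ENNReal) := by
  rw [ENNReal.ofReal]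
  congr 1
  ext
  simp [Real.toNNReal_of_nonneg p.2.1]

/-- A thresholded uniform variable is Bernoulli(`p`). -/
lemma map_thresholdCoord (p : unitInterval) :
    (volume : Measure unitInterval).map (thresholdCoord p) = bernoulliMeasure true false p := by
  refine Measure.ext_of_singleton fun c => ?_
  rw [Measure.map_apply (measurable_thresholdCoord p) (measurableSet_singleton c)]
  cases c
  · rw [thresholdCoord_preimage_false, unitInterval.volume_Ioi,
      bernoulliMeasure_apply_of_notMem_of_mem _ (measurableSet_singleton _) (by simp) (by simp),
      ← unitInterval.coe_symm_eq, ofReal_eq_toNNReal]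
  · rw [thresholdCoord_preimage_true, unitInterval.volume_Iic,
      bernoulliMeasure_apply_of_mem_of_notMem _ (measurableSet_singleton _) (by simp) (by simp),
      ofReal_eq_toNNReal]

/-- The standard coupling: thresholding i.i.d. uniforms at level `p` has law `P_p`. -/
lemma map_threshold (p : unitInterval) : (uniformProd d).map (threshold p) = percMeasure d p := by
  unfold uniformProd percMeasure
  have h := Measure.infinitePi_map_pi (μ := fun _ : Bond d => (volume : Measure unitInterval))
    (f := fun _ => thresholdCoord p) fun _ => measurable_thresholdCoord p
  simp only [map_thresholdCoord] at h
  exact h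

/-- Thresholds are monotone in the level. -/
lemma threshold_mono {p q : unitInterval} (hpq : p ≤ q) (u : Bond d → unitInterval) (b : Bond d)
    (h : threshold p u b = true) : threshold q u b = true := by
  simp only [threshold, thresholdCoord, decide_eq_true_eq] at h ⊢
  exact h.trans hpq

/-! ### Monotonicity (L1) -/

/-- An event is increasing if it is preserved by opening more bonds. -/
def Increasing (A : Set (Config d)) : Prop :=
  ∀ ω ω' : Config d, (∀ b, ω b = true → ω' b = true) → ω ∈ A → ω' ∈ A

/-- Opening more bonds only creates connections. -/
lemma conn_mono {ω ω' : Config d} (h : ∀ b, ω b = true → ω' b = true) {x y : Vertex d}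
    (hc : Conn ω x y) : Conn ω' x y := by
  induction hc with
  | refl => exact Relation.ReflTransGen.refl
  | tail _ hadj ih =>
    obtain ⟨b, hb, hxy⟩ := hadj
    exact ih.tail ⟨b, h b hb, hxy⟩

/-- `{|C(0)| = ∞}` is an increasing event. -/
lemma increasing_infCluster : Increasing (InfCluster d) :=
  fun _ _ h hinf => hinf.mono fun _ hx => conn_mono h hx

/-- L1 (general form): `P_p(A) ≤ P_q(A)` for `p ≤ q` and increasing measurable `A`. -/
lemma percMeasure_mono_of_increasing {A : Set (Config d)} (hA : Increasing A) (hm : MeasurableSet A)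
    {p q : unitInterval} (hpq : p ≤ q) : percMeasure d p A ≤ percMeasure d q A := by
  rw [← map_threshold p, ← map_threshold q, Measure.map_apply (measurable_threshold p) hm,
    Measure.map_apply (measurable_threshold q) hm]
  refine measure_mono fun u hu => ?_
  exact hA _ _ (threshold_mono hpq u) hu

/-- L1: `θ_d` is nondecreasing on `[0,1]`. -/
lemma θ_mono (d : ℕ) : Monotone (θ d) := by
  intro p q hpq
  unfold θ
  rw [measureReal_def, measureReal_def]
  exact ENNReal.toReal_mono (measure_ne_top _ _)
    (percMeasure_mono_of_increasing increasing_infCluster measurableSet_infCluster hpq)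

/-! ### Right-continuity (G4) -/

/-- G4: `θ_d` is right-continuous at every `p ∈ [0,1]`: `θ_d(q) → θ_d(p)` as `q ↓ p`. -/
theorem θ_rightContinuous (d : ℕ) (p : unitInterval) :
    Filter.Tendsto (θ d) (nhdsWithin p (Set.Ioi p)) (nhds (θ d p)) := by
  rw [tendsto_order]
  constructor
  · intro a ha
    exact eventually_nhdsWithin_of_forall fun q hq => lt_of_lt_of_le ha (θ_mono d (le_of_lt hq))
  · intro b hb
    obtain ⟨n, hn⟩ : ∃ n, (percMeasure d p).real (Reach d n) < b :=
      ((tendsto_order.1 (tendsto_reach (d := d) p)).2 b hb).exists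
    have hcont : Filter.Tendsto (fun q => (percMeasure d q).real (Reach d n))
        (nhdsWithin p (Set.Ioi p)) (nhds ((percMeasure d p).real (Reach d n))) :=
      ((continuous_reach (d := d) n).tendsto p).mono_left nhdsWithin_le_nhds
    exact ((tendsto_order.1 hcont).2 b hn).mono fun q hq => lt_of_le_of_lt (θ_le_reach q n) hq

/-- G4 (upper semicontinuity form): `θ_d` is upper semicontinuous on `[0,1]`. -/
theorem θ_upperSemicontinuous (d : ℕ) : UpperSemicontinuous (θ d) := by
  intro p b hb
  obtain ⟨n, hn⟩ : ∃ n, (percMeasure d p).real (Reach d n) < b :=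
    ((tendsto_order.1 (tendsto_reach (d := d) p)).2 b hb).exists
  have hcont := (continuous_reach (d := d) n).continuousAt (x := p)
  exact ((tendsto_order.1 hcont).2 b hn).mono fun q hq => lt_of_le_of_lt (θ_le_reach q n) hq

-- END BODY

end Summit.Ventures.PercRepro0
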